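import Literature.AlgebraicGeometry.ModuliOfAbelianVarieties.SiegelSpaceComplexStructures
import HarnessLib

/-!
# The period matrix of a symplectic complex structure from its left `+i`-eigenrows
# (Lange 2023, §7.1.2 (7.3): `(Z, Δ)·J = i·(Z, Δ)`)

Topic `AlgebraicGeometry/ModuliOfAbelianVarieties`; namespace
`Literature.AlgebraicGeometry.ModuliOfAbelianVarieties.SiegelModuli` (sequel of ★ `SiegelSpaceComplexStructures`:
`C0 δ`, `jOfSiegel δ Z`, `siegelOfJ δ J`, (7.3) `siegelPeriodMatrix_mul_jOfSiegel`).  THEOREMS ONLY.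

Lange's commutative diagram (7.3), `(Z, Δ) ∘ J = i·(Z, Δ)` on `ℝ^{2g} → ℂ^g`, says that the ROWS of the period matrix
`(Z, Δ)` of `J ∈ C₀(Sp(V, E))` are left `+i`-eigenrows of the complexified `J`.  Conversely, since the block
`β = J₁₂` of `J ∈ C₀` is invertible (★ `isUnit_det_toBlocks₁₂`), EVERY left `+i`-eigenrow `r = (r₁ | r₂)` of `J_ℂ` is a
left multiple of the rows of `(Z, Δ)`: `r₁ = r₂·Δ⁻¹·Z` (`toCols₁_eq_toCols₂_mul`).  Hence the period matrix is read
off ANY `g` independent left `+i`-eigenrows `R = (R₁ | R₂)`: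

* `isUnit_toCols₂_of_vecMul_injective` — `R₂` is invertible;
* **`siegelOfJ_eq_of_leftEigenrows`** — `Z(J) = Δ·R₂⁻¹·R₁`.

This is the device by which a period matrix is computed from a frame of the Hodge filtration that depends
holomorphically on parameters (consumer: the period chart of the unitary-to-Siegel embedding, cell hodgecm-mathlib).

## References
* [Lange2023AbelianVarietiesComplex] H. Lange, *Abelian Varieties over the Complex Numbers* (2023), §7.1.2, (7.2)–(7.3),
  Lemma 7.1.6 (p0327).
-/

noncomputable section

open Matrix Complex
open scoped ComplexOrder

namespace Literature.AlgebraicGeometry.ModuliOfAbelianVarieties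

open Literature.NumberTheory.Automorphic (siegelUpperHalfSpace)

namespace SiegelModuli

variable {g : ℕ} {δ : Fin g → ℕ} {J : Matrix (Fin g ⊕ Fin g) (Fin g ⊕ Fin g) ℝ}

/-- `Δ_ℂ` is invertible for `δ_i ≥ 1`. [cite: Lange2023AbelianVarietiesComplex, §7.1.2 Lemma 7.1.6 (p0327)] -/
theorem isUnit_det_diagonal_delta (hδ : ∀ i, 0 < δ i) : IsUnit (diagonal fun i ↦ (δ i : ℂ)).det := by
  rw [det_diagonal]
  exact IsUnit.mk0 _ (Finset.prod_ne_zero_iff.2 fun i _ ↦ by exact_mod_cast (hδ i).ne')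

/-- The period matrix is `(Z | Δ_ℂ)` columnwise. [cite: Lange2023AbelianVarietiesComplex, §3.1.1 («Π = (Z, D)») (p0157)] -/
theorem siegelPeriodMatrix_eq_fromCols (δ : Fin g → ℕ) (Z : Matrix (Fin g) (Fin g) ℂ) :
    siegelPeriodMatrix δ Z = fromCols Z (diagonal fun i ↦ (δ i : ℂ)) := rfl

/-- **Every left `+i`-eigenrow of `J_ℂ` is a left multiple of the rows of `(Z, Δ)`** (`J ∈ C₀`, `Z = Z(J)` its
period matrix): for a matrix `R = (R₁ | R₂)` of rows with `R·J_ℂ = i·R` one has `R₁ = R₂·Δ⁻¹·Z`.  Proof: `(Z, Δ)`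
satisfies the same relation ((7.3)), so does `D = R − R₂Δ⁻¹(Z, Δ) = (Q | 0)`; then `(Q | 0)·J_ℂ = (Qα | Qβ) = (iQ | 0)`
forces `Qβ = 0`, and `β = J₁₂` is invertible. [cite: Lange2023AbelianVarietiesComplex, §7.1.2 (7.3) and Lemma 7.1.6 (p0327)] -/
theorem toCols₁_eq_toCols₂_mul {ι : Type} [Fintype ι] (hδ : ∀ i, 0 < δ i) (hJ : J ∈ C0 δ)
    (R : Matrix ι (Fin g ⊕ Fin g) ℂ) (hR : R * J.map ((↑) : ℝ → ℂ) = Complex.I • R) :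
    R.toCols₁ = R.toCols₂ * (diagonal fun i ↦ (δ i : ℂ))⁻¹ * siegelOfJ δ J := by
  set Z := siegelOfJ δ J with hZ
  set Δc : Matrix (Fin g) (Fin g) ℂ := diagonal fun i ↦ (δ i : ℂ) with hΔc
  have hZmem : Z ∈ siegelUpperHalfSpace g := siegelOfJ_mem hJ
  have hY : IsUnit (Z.map im).det := (Matrix.isUnit_iff_isUnit_det _).1 hZmem.2.isUnit
  have hΔ : IsUnit Δc.det := isUnit_det_diagonal_delta hδ
  -- (7.3) for the rows of `(Z, Δ)`
  have h73 : fromCols Z Δc * J.map ((↑) : ℝ → ℂ) = Complex.I • fromCols Z Δc := by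
    have h := siegelPeriodMatrix_mul_jOfSiegel (δ := δ) hδ hY
    rw [hZ, jOfSiegel_siegelOfJ hJ hδ, ← hZ, siegelPeriodMatrix_eq_fromCols] at h
    exact h
  -- the difference `D = R − R₂Δ⁻¹(Z, Δ)`
  set D : Matrix ι (Fin g ⊕ Fin g) ℂ := R - R.toCols₂ * Δc⁻¹ * fromCols Z Δc with hD
  have hDJ : D * J.map ((↑) : ℝ → ℂ) = Complex.I • D := by
    rw [hD, Matrix.sub_mul, Matrix.mul_assoc (R.toCols₂ * Δc⁻¹), h73, hR, Matrix.mul_smul, smul_sub]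
  have hD2 : D.toCols₂ = 0 := by
    have h1 : (R.toCols₂ * Δc⁻¹ * fromCols Z Δc).toCols₂ = R.toCols₂ := by
      rw [mul_fromCols, toCols₂_fromCols, Matrix.mul_assoc, nonsing_inv_mul _ hΔ, Matrix.mul_one]
    have : D.toCols₂ = R.toCols₂ - (R.toCols₂ * Δc⁻¹ * fromCols Z Δc).toCols₂ := by
      rw [hD]; rfl
    rw [this, h1, sub_self]
  -- write `J_ℂ` in blocks and read the second block column of `D·J_ℂ = iD`
  have hJblocks : J.map ((↑) : ℝ → ℂ) = fromBlocks (J.toBlocks₁₁.map (↑)) (J.toBlocks₁₂.map (↑))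
      (J.toBlocks₂₁.map (↑)) (J.toBlocks₂₂.map ((↑) : ℝ → ℂ)) := by
    conv_lhs => rw [← fromBlocks_toBlocks J]
    rw [fromBlocks_map]
  have hDsplit : D = fromCols D.toCols₁ 0 := by rw [← hD2, fromCols_toCols]
  have hsmul : ∀ (A : Matrix ι (Fin g) ℂ) (B : Matrix ι (Fin g) ℂ) (c : ℂ),
      c • fromCols A B = fromCols (c • A) (c • B) := fun A B c ↦ by
    ext i (j | j) <;> rfl
  have hQβ : D.toCols₁ * J.toBlocks₁₂.map ((↑) : ℝ → ℂ) = 0 := by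
    have h := hDJ
    rw [hDsplit, hJblocks, fromCols_mul_fromBlocks, hsmul, Matrix.zero_mul, Matrix.zero_mul, add_zero,
      add_zero, smul_zero] at h
    exact ((fromCols_ext_iff _ _ _ _).1 h).2
  have hβ : IsUnit (J.toBlocks₁₂.map ((↑) : ℝ → ℂ)).det := by
    have h := isUnit_det_toBlocks₁₂ hJ
    have : (J.toBlocks₁₂.map ((↑) : ℝ → ℂ)).det = ((J.toBlocks₁₂).det : ℂ) := by
      have hm := RingHom.map_det Complex.ofRealHom J.toBlocks₁₂
      rw [RingHom.mapMatrix_apply] at hm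
      exact hm.symm
    rw [this]
    exact h.map Complex.ofRealHom
  have hQ : D.toCols₁ = 0 := by
    calc D.toCols₁ = D.toCols₁ * J.toBlocks₁₂.map ((↑) : ℝ → ℂ) * (J.toBlocks₁₂.map ((↑) : ℝ → ℂ))⁻¹ := by
          rw [mul_nonsing_inv_cancel_right _ _ hβ]
      _ = 0 := by rw [hQβ, Matrix.zero_mul]
  have hD0 : D = 0 := by rw [hDsplit, hQ, fromCols_zero]
  have hRR : R = R.toCols₂ * Δc⁻¹ * fromCols Z Δc := by
    rw [← sub_eq_zero]; exact hD0
  calc R.toCols₁ = (R.toCols₂ * Δc⁻¹ * fromCols Z Δc).toCols₁ := by rw [← hRR]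
    _ = R.toCols₂ * Δc⁻¹ * Z := by rw [mul_fromCols, toCols₁_fromCols]

/-- **Independent left `+i`-eigenrows have an invertible `Δ`-block**: if `R = (R₁ | R₂)` has `g` linearly
independent rows with `R·J_ℂ = i·R` (`J ∈ C₀`), then `R₂` is invertible (by `toCols₁_eq_toCols₂_mul`, `R = R₂·Δ⁻¹·(Z, Δ)`
factors through `R₂`). [cite: Lange2023AbelianVarietiesComplex, §7.1.2 (7.3) (p0327)] -/
theorem isUnit_toCols₂_of_vecMul_injective (hδ : ∀ i, 0 < δ i) (hJ : J ∈ C0 δ)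
    (R : Matrix (Fin g) (Fin g ⊕ Fin g) ℂ) (hR : R * J.map ((↑) : ℝ → ℂ) = Complex.I • R)
    (hinj : Function.Injective R.vecMul) : IsUnit R.toCols₂ := by
  rw [← vecMul_injective_iff_isUnit]
  intro x y hxy
  apply hinj
  have hRR : R = R.toCols₂ * ((diagonal fun i ↦ (δ i : ℂ))⁻¹ * siegelPeriodMatrix δ (siegelOfJ δ J)) := by
    rw [siegelPeriodMatrix_eq_fromCols, ← Matrix.mul_assoc, mul_fromCols, ← toCols₁_eq_toCols₂_mul hδ hJ R hR,
      Matrix.mul_assoc, nonsing_inv_mul _ (isUnit_det_diagonal_delta hδ), Matrix.mul_one, fromCols_toCols]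
  have hxy' : x ᵥ* R.toCols₂ = y ᵥ* R.toCols₂ := hxy
  show x ᵥ* R = y ᵥ* R
  rw [hRR, ← vecMul_vecMul, ← vecMul_vecMul, hxy', vecMul_vecMul, vecMul_vecMul]

/-- **The period matrix from left eigenrows**: for `J ∈ C₀` and `g` independent left `+i`-eigenrows
`R = (R₁ | R₂)` of `J_ℂ`, **`Z(J) = Δ·R₂⁻¹·R₁`** (Lange's (7.3) solved for `Z`; with `R = (Z, Δ)` itself this is
Lemma 7.1.6 (1)). [cite: Lange2023AbelianVarietiesComplex, §7.1.2 (7.3) and Lemma 7.1.6 (1) (p0327)] -/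
theorem siegelOfJ_eq_of_leftEigenrows (hδ : ∀ i, 0 < δ i) (hJ : J ∈ C0 δ)
    (R : Matrix (Fin g) (Fin g ⊕ Fin g) ℂ) (hR : R * J.map ((↑) : ℝ → ℂ) = Complex.I • R)
    (hinj : Function.Injective R.vecMul) :
    siegelOfJ δ J = (diagonal fun i ↦ (δ i : ℂ)) * R.toCols₂⁻¹ * R.toCols₁ := by
  have h2 : IsUnit R.toCols₂.det :=
    (Matrix.isUnit_iff_isUnit_det _).1 (isUnit_toCols₂_of_vecMul_injective hδ hJ R hR hinj)
  have hΔ := isUnit_det_diagonal_delta (g := g) hδ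
  rw [toCols₁_eq_toCols₂_mul hδ hJ R hR]
  symm
  calc (diagonal fun i ↦ (δ i : ℂ)) * R.toCols₂⁻¹ *
        (R.toCols₂ * (diagonal fun i ↦ (δ i : ℂ))⁻¹ * siegelOfJ δ J)
      = (diagonal fun i ↦ (δ i : ℂ)) * (R.toCols₂⁻¹ * R.toCols₂) * (diagonal fun i ↦ (δ i : ℂ))⁻¹ *
          siegelOfJ δ J := by simp only [Matrix.mul_assoc]
    _ = siegelOfJ δ J := by
        rw [nonsing_inv_mul _ h2, Matrix.mul_one, mul_nonsing_inv _ hΔ, Matrix.one_mul]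

end SiegelModuli

end Literature.AlgebraicGeometry.ModuliOfAbelianVarieties
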